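import Summits.ResolutionOfSingularities.ResolutionOfSingularities.Theorems.EquisingularLiftEquisingularLiftNatNDTransportStep
import Summits.ResolutionOfSingularities.ResolutionOfSingularities.Theorems.EquisingularLiftEquisingularLiftNatNDRoundPropsP
import Summits.ResolutionOfSingularities.ResolutionOfSingularities.Theorems.EquisingularLiftEquisingularLiftNatNDFrameRegular
import HarnessLib

/-!
# [OURS · L1 W4.5(b) · EL♮(3)] (L-β1) `transportStep₀` — `…NatNDTransportStepP`: the (B4β1) linked step WITHOUT the ambient-regularity binder
# (desk RULING R36 (α) «(K-reg) = (i) LOCALISE, strong form L0», R36′ (1), WIDTH TABLE D2 «K-LOC» row (L-β1) = res-L1-w45b-iso-w1; audit `L/res-L1-w45b-iso-w1/KREG-AUDIT-v1.md`)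

OURS · L1 W4.5(b) · EL♮(3) stmt-ResolutionOfSingularities-20148 (parent EL♮ stmt-…-20038) · counted 0 · AI-written (res-L1-w45b-iso-w1 g0), weaker than expert
review; nothing of [Hironaka2017] asserted; no statement of the manuscript.  Sorry-free, def-free, standard axioms, no instance, no notation.
`--supports stmt-ResolutionOfSingularities-20148 --as helper`: the brick closes BY NAME against the text owner's port ✓ p649163 `…NatNDRoundPropsP`
(`ND.TransportStep₀` = ✓ p643982 `ND.TransportStep` minus the binder `Scheme.IsRegular F₁ →`, token-identical otherwise) for the «ND-LEAVES» programme (R33 (β),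
SPEC K6-loc): `transportRoundLN₀_of_toricStage` / `ndInvLN₀_round_of` (nose-w4, (L-δ)) consume it with (L-β0) `transportInit₀` (stub-2) and (L-β2) `transportEnd₀` (iso-w2).
PROOF = res-L1-w45b-nose-w2's landed proof of `ND.transportStep` (✓ p644680) VERBATIM — its §1 helpers are imported, not copied — with exactly two edits:
the `intro` pattern loses `hreg`, and the one consumption of ambient regularity (p644680 l.230, `hreg x`, needed for `ND.flat_frameChart` at the round point) is
replaced by R0 `ND.isRegularLocalRing_of_span_range_eq w h2 h3` (✓ p648331): an r.s.p. of length `n = dim` in the Noetherian stalk (`IsLocallyNoetherian F₁`) makes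
`𝒪_{F₁,x}` regular.  `[IsAlgClosed k]` is the SPEC's binder and is not used (as in the original).
-/

set_option linter.dupNamespace false

noncomputable section

open CategoryTheory CategoryTheory.Limits AlgebraicGeometry TopologicalSpace Topology
open Literature.AlgebraicGeometry.Resolution
open AlgebraicGeometry.Scheme.IdealSheafData

namespace Summit.ResolutionOfSingularities.ResolutionOfSingularities.Cruxes.EquisingularLiftNat.Sections.ND

open Summit.ResolutionOfSingularities.ResolutionOfSingularities.Cruxes.EquisingularLiftNat.Sections

section RoundModel

variable (n : ℕ) (k : Type) [Field k]

/-- **(L-β1) `transportStep₀` — ONE LINKED STEP of the (B4β) transport, pointwise variant** (`ND.TransportStep₀`, ✓ p649163): at an F-stage linked over `Spec 𝒪_{F₁,x}`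
to a model toric stage, a model move is F-legal, and any blow-up of the F-side stratum gives the next F-stage, linked to the model's next stage — with NO ambient
regularity of `F₁` assumed: the only regularity the step needs, at the round point `x` (flatness of the frame chart), is read off the frame data `w` (r.s.p., `dim = n`)
by `isRegularLocalRing_of_span_range_eq`.  Everything else is nose-w2's `transportStep` argument verbatim (flat legs of the link, the three centres, F-legality through
`L`, `n ≥ 2` by `two_le_of_exists_notMem_range_e`, the new F-stage, the new link by flat base change + uniqueness of blow-ups).  [OURS · L1 W4.5b · (L-β1) by name · iso-w1] -/
theorem transportStep₀ [IsAlgClosed k] : TransportStep₀ n k := by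
  intro F₁ ρ T₁ hF₁ hT₁ x hx W w g h1 h2 h3 h4 h5 Φ F φF EF TF A φA EA TA hFS hL hTS σ hσ τ hτσ hBad hτ hfresh hE1A hTA
    A' υA hυA hTS'
  obtain ⟨hFn, hiso, hbook, hTFcl, hEFx⟩ := hFS
  obtain ⟨L, a, b, c, Ha, Hb, hEab, hTab⟩ := hL
  obtain ⟨hTS0, hcharts, -, -, hTAcl, -⟩ := hTS
  obtain ⟨-, hcharts', -, -, -, -⟩ := hTS'
  haveI := hF₁
  haveI := hFn
  haveI := hiso
  -- (K-LOC, desk R36 (α)): the round point's regularity comes from the frame data (R0, ✓ p648331), not from a global hypothesis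
  haveI : IsRegularLocalRing (F₁.presheaf.stalk x) := isRegularLocalRing_of_span_range_eq w h2 h3
  -- flatness of the two legs of the link
  haveI : Flat (F₁.fromSpecStalk x) := flat_fromSpecStalk F₁ x
  haveI : Flat a := MorphismProperty.of_isPullback Ha.flip ‹Flat (F₁.fromSpecStalk x)›
  haveI : Flat (frameBaseMap n k ρ x w) := by
    unfold frameBaseMap
    exact flat_specMap_frameChart k ρ x w h2 h3
  haveI : Flat b := MorphismProperty.of_isPullback Hb.flip ‹Flat (frameBaseMap n k ρ x w)›
  -- the model stages are locally Noetherian and `φA` is locally of finite type (𝔸ⁿ-charts), so `L` is locally Noetherian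
  haveI : IsLocallyNoetherian A := isLocallyNoetherian_of_affineCharts k
    (fun y => by obtain ⟨_, _, _, c', hc', hy, -⟩ := hcharts y; exact ⟨c', hc', hy⟩)
  haveI : IsLocallyNoetherian A' := isLocallyNoetherian_of_affineCharts k
    (fun y => by obtain ⟨_, _, _, c', hc', hy, -⟩ := hcharts' y; exact ⟨c', hc', hy⟩)
  haveI : LocallyOfFiniteType φA := locallyOfFiniteType_of_affineCharts k φA
    (fun y => by
      obtain ⟨_, _, B, c', hc', hy, -, -, hcφ, -⟩ := hcharts y
      exact ⟨c', MvPolynomial.aeval fun l => ∏ i, (MvPolynomial.X i : MvPolynomial (Fin n) k) ^ B i l, hc', hy, hcφ⟩)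
  haveI : LocallyOfFiniteType c := MorphismProperty.of_isPullback Hb ‹LocallyOfFiniteType φA›
  haveI : IsLocallyNoetherian L := LocallyOfFiniteType.isLocallyNoetherian c
  -- the three centres
  have hEabF : (fun ρ => (EF ρ).comap a) = (fun ρ => (EA ρ).comap b) := funext hEab
  have hCab : (stratum EF τ).comap a = (stratum EA τ).comap b := by
    rw [← stratum_comap, ← stratum_comap, hEabF]
  have hsuppab : a ⁻¹' ((stratum EF τ).support : Set F) = b ⁻¹' ((stratum EA τ).support : Set A) := by
    rw [← coe_support_stratum_comap, ← coe_support_stratum_comap, hEabF]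
  -- the centre lies over `x`, hence inside the image of `a`
  obtain ⟨ρ₀, hρ₀τ, hρ₀⟩ := hτ
  have hCFx : ((stratum EF τ).support : Set F) ⊆ φF ⁻¹' {x} := (coe_support_stratum_subset EF hρ₀τ).trans (hEFx ρ₀ hρ₀)
  have hCF_range : ((stratum EF τ).support : Set F) ⊆ Set.range a := by
    intro y hy
    rw [range_fst_of_isPullback Ha, Set.mem_preimage, (hCFx hy : φF y = x)]
    exact ⟨IsLocalRing.closedPoint _, Scheme.fromSpecStalk_closedPoint⟩
  -- (1) F-legality
  have hE1F : ((stratum EF τ).support : Set F) ⊆ TF := by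
    intro y hy
    obtain ⟨l, rfl⟩ := hCF_range hy
    have hl : l ∈ a ⁻¹' ((stratum EF τ).support : Set F) := hy
    rw [hsuppab] at hl
    have hl' : l ∈ b ⁻¹' TA := hE1A hl
    rw [← hTab] at hl'
    exact hl'
  have hn : 2 ≤ n := two_le_of_exists_notMem_range_e (hTS0 σ hσ) hτσ ⟨ρ₀, hρ₀τ, hρ₀⟩
  have hT₁x : ¬ T₁ ⊆ {x} := not_subset_singleton_of_frame ρ hx w g hn h2 h3 h4.1.1.1 h5
  have hTF : ¬ TF ⊆ ((stratum EF τ).support : Set F) := by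
    intro hsub
    apply hT₁x
    intro y hy
    by_contra hyx
    obtain ⟨z, hz⟩ := exists_eq_of_isIso_morphismRestrict φF (⟨{x}ᶜ, hx.isOpen_compl⟩ : F₁.Opens) (y := y) hyx
    have hz' : z ∈ φF ⁻¹' (T₁ \ {x}) := by
      rw [Set.mem_preimage, hz]
      exact ⟨hy, hyx⟩
    rw [← hbook] at hz'
    exact hz'.2 (hCFx (hsub hz'.1))
  refine ⟨⟨hE1F, hTF⟩, fun F' υF hυF => ?_⟩
  haveI : IsLocallyNoetherian F' := hυF.isLocallyNoetherian
  -- (2a) the new F-stage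
  have hFS' : FStage n F₁ x hx T₁ F' (υF ≫ φF) (EF.stepAlong (stratum EF τ) (∑ ρ ∈ τ, ρ) υF)
      (closure (υF ⁻¹' (TF \ ((stratum EF τ).support : Set F)))) := by
    refine ⟨inferInstance, ?_, closure_preimage_diff_inter_eq φF x T₁ hTFcl hCFx hbook υF, isClosed_closure, ?_⟩
    · exact isIso_morphismRestrict_comp_of_isBlowup φF _ hυF (fun y hy => by
        show φF y ∈ (({x}ᶜ : Set F₁))ᶜ
        rw [compl_compl]
        exact hCFx hy)
    · intro ρ hρ
      by_cases hν : ρ = ∑ ρ ∈ τ, ρ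
      · rw [hν, stepAlong_self, support_comap]
        intro z hz
        show (υF ≫ φF) z ∈ ({x} : Set F₁)
        rw [Scheme.Hom.comp_apply]
        exact hCFx hz
      · rw [stepAlong_of_ne _ _ hν]
        have hle : ((strictTransformIdeal υF (stratum EF τ) (EF ρ)).support : Set F') ⊆ (((EF ρ).comap υF).support : Set F') :=
          support_antitone (comap_le_strictTransformIdeal υF (stratum EF τ) (EF ρ))
        refine hle.trans ?_
        rw [support_comap]
        intro z hz
        show (υF ≫ φF) z ∈ ({x} : Set F₁)
        rw [Scheme.Hom.comp_apply]
        exact hEFx ρ hρ hz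
  -- (2b) the new link: `L' := L ×_F F'`, the blow-up of `C_L`, compared with `L ×_A A'`
  have H1 : IsPullback (pullback.fst υF a) (pullback.snd υF a) υF a := IsPullback.of_hasPullback υF a
  haveI : Flat (pullback.fst υF a) := MorphismProperty.of_isPullback H1.flip ‹Flat a›
  have hυL : IsBlowup (pullback.snd υF a) ((stratum EF τ).comap a) := hυF.of_isPullback_of_flat H1
  haveI : IsLocallyNoetherian (pullback υF a : Scheme.{0}) := hυL.isLocallyNoetherian
  have hPA : IsBlowup (pullback.snd υA b) ((stratum EF τ).comap a) := by
    rw [hCab]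
    exact hυA.pullback_snd_of_flat b
  obtain ⟨eI, he, -⟩ := hυL.unique hPA
  have H2 : IsPullback (eI.hom ≫ pullback.fst υA b) (pullback.snd υF a) υA b := by
    refine IsPullback.of_iso_pullback ⟨?_⟩ eI rfl he
    rw [Category.assoc, pullback.condition, ← Category.assoc, he]
  haveI : Flat (eI.hom ≫ pullback.fst υA b) := MorphismProperty.of_isPullback H2.flip ‹Flat b›
  refine ⟨hFS', pullback υF a, pullback.fst υF a, eI.hom ≫ pullback.fst υA b, pullback.snd υF a ≫ c,
    H1.paste_vert Ha, H2.paste_vert Hb, fun ρ => ?_, ?_⟩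
  · have hF' := congrFun (stepAlong_comap_of_flat EF (stratum EF τ) (∑ ρ ∈ τ, ρ) υF a (pullback.fst υF a) (pullback.snd υF a) H1.w) ρ
    have hA' := congrFun (stepAlong_comap_of_flat EA (stratum EA τ) (∑ ρ ∈ τ, ρ) υA b (eI.hom ≫ pullback.fst υA b) (pullback.snd υF a) H2.w) ρ
    rw [hF', hA', hEabF, ← stratum_comap, ← stratum_comap, hEabF]
  · rw [preimage_closure_preimage_diff_of_flat H1.w hTFcl (stratum EF τ).support.isClosed,
      preimage_closure_preimage_diff_of_flat H2.w hTAcl (stratum EA τ).support.isClosed, hTab, hsuppab]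

end RoundModel

end Summit.ResolutionOfSingularities.ResolutionOfSingularities.Cruxes.EquisingularLiftNat.Sections.ND

end
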